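/-
Copyright (c) 2026. All rights reserved.
Released under Apache 2.0 license as described in the file LICENSE.
Authors: abc-iut cell — seat abc-iut-L6-t15 (gen 3): proof-only companion to `HolomorphicCores`
([AbsTopIII] Prop 2.5), no new definitions.
-/
import Literature.AnabelianGeometry.AbsoluteAnabelian.HolomorphicCores
import Mathlib.Analysis.Complex.ReImTopology
import Mathlib.Analysis.LocallyConvex.Separation
import Mathlib.Analysis.Convex.Topology

/-!
# Planar geometry behind [AbsTopIII] Prop 2.5, I: parallelograms and strict line segments

Proof-only companion (no definitions) to `HolomorphicCores.lean` (seats abc-iut-L4-t2/t14), towards the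
named fact `TwoOrientations` ([AbsTopIII] Prop 2.5 pp.55–57).  Contents: an affine frame for
`openParallelogram z v w` (image of the unit square `(0,1)² ⊆ ℂ` under `p ↦ z + p.re • v + p.im • w`, a
homeomorphism when `v, w` are `ℝ`-independent) — openness, convexity, closure, compactness,
`interior (closure P) = P`; `Parallelograms.topology 𝒮(U)` is the subspace topology of `U`; Prop 2.5 (a):
a STRICT LINE SEGMENT of `(U, 𝒮(U))` (an infinite intersection of the closures of two disjoint squares)
is a non-degenerate closed segment (Hahn–Banach separation puts it on a line; a compact convex infinite
subset of a line is a segment).  Refereed classical mathematics (S. Mochizuki, *Topics in absolute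
anabelian geometry III*, §2; kurims pages); nothing here bears on the disputed parts of IUT.
-/

namespace Literature.AnabelianGeometry.AbsoluteAnabelian

open _root_.Complex _root_.Set _root_.Topology _root_.Filter _root_.Metric

noncomputable section

/-! ### The affine frame of a parallelogram -/

/-- Two complex numbers are `ℝ`-linearly independent iff the determinant of their real coordinates is
non-zero. (Auxiliary.) [cite: MochizukiAbsTopIII2015, Proposition 2.5 (proof) pp.55–57] -/
theorem linearIndependent_pair_iff_det (v w : ℂ) :
    LinearIndependent ℝ ![v, w] ↔ v.re * w.im - v.im * w.re ≠ 0 := by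
  rw [LinearIndependent.pair_iff]
  constructor
  · intro h hΔ
    have h1 := h w.re (-v.re) (by
      apply Complex.ext
      · simp; ring
      · simp; linear_combination -hΔ)
    have h2 := h w.im (-v.im) (by
      apply Complex.ext
      · simp; linear_combination hΔ
      · simp; ring)
    have hv : v = 0 := Complex.ext (by simpa using h1.2) (by simpa using h2.2)
    have h3 := h 1 0 (by simp [hv])
    simp at h3
  · intro hΔ s t hst
    have hre := congrArg Complex.re hst
    have him := congrArg Complex.im hst
    simp only [Complex.add_re, Complex.smul_re, smul_eq_mul, Complex.zero_re, Complex.add_im,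
      Complex.smul_im, Complex.zero_im] at hre him
    have hs : s * (v.re * w.im - v.im * w.re) = 0 := by linear_combination w.im * hre - w.re * him
    have ht : t * (v.re * w.im - v.im * w.re) = 0 := by linear_combination -v.im * hre + v.re * him
    exact ⟨(mul_eq_zero.1 hs).resolve_right hΔ, (mul_eq_zero.1 ht).resolve_right hΔ⟩

/-- The real-affine map `p ↦ z + p.re • v + p.im • w` underlying `openParallelogram z v w`, as an
`ℝ`-affine self-map of `ℂ`. (Auxiliary.) [cite: MochizukiAbsTopIII2015, Proposition 2.5 (proof) pp.55–57] -/
theorem exists_affineMap_frame (z v w : ℂ) :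
    ∃ f : ℂ →ᵃ[ℝ] ℂ, ∀ p : ℂ, f p = z + (p.re : ℂ) * v + (p.im : ℂ) * w := by
  refine ⟨(Complex.reLm.smulRight v + Complex.imLm.smulRight w).toAffineMap +
    AffineMap.const ℝ ℂ z, fun p => ?_⟩
  simp only [AffineMap.coe_add, AffineMap.coe_const, Pi.add_apply, LinearMap.coe_toAffineMap,
    LinearMap.add_apply, LinearMap.smulRight_apply, Complex.reLm_coe, Complex.imLm_coe,
    Function.const_apply, Complex.real_smul]
  ring

/-- When `v, w` are `ℝ`-independent, the affine frame `p ↦ z + p.re • v + p.im • w` is a self-homeomorphism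
of `ℂ`. (Auxiliary.) [cite: MochizukiAbsTopIII2015, Proposition 2.5 (proof) pp.55–57] -/
theorem exists_homeomorph_frame (z v w : ℂ) (h : LinearIndependent ℝ ![v, w]) :
    ∃ A : ℂ ≃ₜ ℂ, ∀ p : ℂ, A p = z + (p.re : ℂ) * v + (p.im : ℂ) * w := by
  have hΔ := (linearIndependent_pair_iff_det v w).1 h
  set Δ := v.re * w.im - v.im * w.re with hΔdef
  let L : ℂ ≃ₗ[ℝ] ℂ :=
    { toFun := fun p => (p.re : ℂ) * v + (p.im : ℂ) * w
      map_add' := fun p q => by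
        simp only [Complex.add_re, Complex.add_im, Complex.ofReal_add]; ring
      map_smul' := fun r p => by
        simp only [RingHom.id_apply, Complex.real_smul, Complex.re_ofReal_mul, Complex.im_ofReal_mul,
          Complex.ofReal_mul]
        ring
      invFun := fun x => ⟨(x.re * w.im - x.im * w.re) / Δ, (v.re * x.im - v.im * x.re) / Δ⟩
      left_inv := fun p => by
        apply Complex.ext <;> simp <;> field_simp <;> ring
      right_inv := fun x => by
        apply Complex.ext <;> simp <;> field_simp <;> ring }
  refine ⟨L.toContinuousLinearEquiv.toHomeomorph.trans (Homeomorph.addLeft z), fun p => ?_⟩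
  show z + ((p.re : ℂ) * v + (p.im : ℂ) * w) = _
  ring

/-- `openParallelogram z v w` is the image of the open unit square `(0,1) ×ℂ (0,1)` under the affine
frame. [cite: MochizukiAbsTopIII2015, Proposition 2.5 p.55] -/
theorem openParallelogram_eq_image (z v w : ℂ) {A : ℂ → ℂ}
    (hA : ∀ p : ℂ, A p = z + (p.re : ℂ) * v + (p.im : ℂ) * w) :
    openParallelogram z v w = A '' (Ioo 0 1 ×ℂ Ioo 0 1) := by
  ext x
  simp only [openParallelogram, mem_setOf_eq, mem_image, mem_reProdIm, mem_Ioo]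
  constructor
  · rintro ⟨s, t, hs, hs', ht, ht', rfl⟩
    exact ⟨⟨s, t⟩, ⟨⟨hs, hs'⟩, ht, ht'⟩, by rw [hA]⟩
  · rintro ⟨p, ⟨⟨h1, h2⟩, h3, h4⟩, rfl⟩
    exact ⟨p.re, p.im, h1, h2, h3, h4, hA p⟩

/-- Every `openParallelogram z v w` is convex. [cite: MochizukiAbsTopIII2015, Proposition 2.5 p.55] -/
theorem convex_openParallelogram (z v w : ℂ) : Convex ℝ (openParallelogram z v w) := by
  obtain ⟨f, hf⟩ := exists_affineMap_frame z v w
  rw [openParallelogram_eq_image z v w hf]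
  exact ((convex_Ioo 0 1).linear_preimage Complex.reLm |>.inter
    ((convex_Ioo 0 1).linear_preimage Complex.imLm)).affine_image f

/-- A non-degenerate `openParallelogram z v w` is open.
[cite: MochizukiAbsTopIII2015, Proposition 2.5 p.55] -/
theorem isOpen_openParallelogram {z v w : ℂ} (h : LinearIndependent ℝ ![v, w]) :
    IsOpen (openParallelogram z v w) := by
  obtain ⟨A, hA⟩ := exists_homeomorph_frame z v w h
  rw [openParallelogram_eq_image z v w hA]
  exact A.isOpenMap _ (isOpen_Ioo.reProdIm isOpen_Ioo)

/-- The closure of a non-degenerate `openParallelogram z v w` is the image of the closed unit square.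
[cite: MochizukiAbsTopIII2015, Proposition 2.5 p.55] -/
theorem closure_openParallelogram {z v w : ℂ} (h : LinearIndependent ℝ ![v, w]) {A : ℂ → ℂ}
    (hA : ∀ p : ℂ, A p = z + (p.re : ℂ) * v + (p.im : ℂ) * w) :
    closure (openParallelogram z v w) = A '' (Icc 0 1 ×ℂ Icc 0 1) := by
  obtain ⟨B, hB⟩ := exists_homeomorph_frame z v w h
  have hAB : A = ⇑B := funext fun p => by rw [hA, hB]
  rw [openParallelogram_eq_image z v w hA, hAB, ← B.image_closure, Complex.closure_reProdIm,
    closure_Ioo zero_ne_one]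

/-- Membership in the closure of a non-degenerate parallelogram, in coordinates.
[cite: MochizukiAbsTopIII2015, Proposition 2.5 p.55] -/
theorem mem_closure_openParallelogram_iff {z v w : ℂ} (h : LinearIndependent ℝ ![v, w]) {x : ℂ} :
    x ∈ closure (openParallelogram z v w) ↔
      ∃ s t : ℝ, 0 ≤ s ∧ s ≤ 1 ∧ 0 ≤ t ∧ t ≤ 1 ∧ x = z + (s : ℂ) * v + (t : ℂ) * w := by
  obtain ⟨f, hf⟩ := exists_affineMap_frame z v w
  rw [closure_openParallelogram h hf]
  simp only [mem_image, mem_reProdIm, mem_Icc]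
  constructor
  · rintro ⟨p, ⟨⟨h1, h2⟩, h3, h4⟩, rfl⟩
    exact ⟨p.re, p.im, h1, h2, h3, h4, hf p⟩
  · rintro ⟨s, t, hs, hs', ht, ht', rfl⟩
    exact ⟨⟨s, t⟩, ⟨⟨hs, hs'⟩, ht, ht'⟩, by rw [hf]⟩

/-- The closure of a non-degenerate parallelogram is compact.
[cite: MochizukiAbsTopIII2015, Proposition 2.5 p.55] -/
theorem isCompact_closure_openParallelogram {z v w : ℂ} (h : LinearIndependent ℝ ![v, w]) :
    IsCompact (closure (openParallelogram z v w)) := by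
  obtain ⟨A, hA⟩ := exists_homeomorph_frame z v w h
  rw [closure_openParallelogram h hA]
  exact (isCompact_Icc.reProdIm isCompact_Icc).image A.continuous

/-- The closure of a parallelogram is convex. [cite: MochizukiAbsTopIII2015, Proposition 2.5 p.55] -/
theorem convex_closure_openParallelogram (z v w : ℂ) :
    Convex ℝ (closure (openParallelogram z v w)) :=
  (convex_openParallelogram z v w).closure

/-- A non-degenerate parallelogram is the interior of its closure.
[cite: MochizukiAbsTopIII2015, Proposition 2.5 (c) p.56] -/
theorem interior_closure_openParallelogram {z v w : ℂ} (h : LinearIndependent ℝ ![v, w]) :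
    interior (closure (openParallelogram z v w)) = openParallelogram z v w := by
  obtain ⟨A, hA⟩ := exists_homeomorph_frame z v w h
  rw [closure_openParallelogram h hA, ← A.image_interior, Complex.interior_reProdIm, interior_Icc,
    ← openParallelogram_eq_image z v w hA]

/-- A non-degenerate parallelogram is non-empty. [cite: MochizukiAbsTopIII2015, Proposition 2.5 p.55] -/
theorem openParallelogram_nonempty (z v w : ℂ) : (openParallelogram z v w).Nonempty :=
  ⟨_, 2⁻¹, 2⁻¹, by norm_num, by norm_num, by norm_num, by norm_num, rfl⟩


/-- For `v ≠ 0`, the pair `(v, I v)` spanning a square is `ℝ`-independent. (Auxiliary.) [cite: MochizukiAbsTopIII2015, Proposition 2.5 (proof) pp.55–57] -/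
theorem linearIndependent_pair_mul_I {v : ℂ} (hv : v ≠ 0) : LinearIndependent ℝ ![v, I * v] := by
  rw [linearIndependent_pair_iff_det]
  simp only [Complex.I_mul_re, Complex.I_mul_im, ne_eq]
  intro h
  apply hv
  have : v.re * v.re + v.im * v.im = 0 := by linear_combination h
  have hre : v.re = 0 := by nlinarith
  have him : v.im = 0 := by nlinarith
  exact Complex.ext hre him

/-! ### The squares generate the topology of `U` -/

/-- Small squares: every point of an open `W ⊆ ℂ` lies in an open square whose closure is contained in
`W`. (Auxiliary.) [cite: MochizukiAbsTopIII2015, Proposition 2.5 (proof) pp.55–57] -/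
theorem exists_square_closure_subset {W : Set ℂ} (hW : IsOpen W) {x : ℂ} (hx : x ∈ W) :
    ∃ z v : ℂ, v ≠ 0 ∧ x ∈ openParallelogram z v (I * v) ∧
      closure (openParallelogram z v (I * v)) ⊆ W := by
  obtain ⟨ε, hε, hball⟩ := Metric.isOpen_iff.1 hW x hx
  set r : ℝ := ε / 2 with hr
  have hr0 : 0 < r := by positivity
  refine ⟨x - (r / 2 : ℝ) - (r / 2 : ℝ) * I, r, by exact_mod_cast hr0.ne', ?_, ?_⟩
  · refine ⟨2⁻¹, 2⁻¹, by norm_num, by norm_num, by norm_num, by norm_num, ?_⟩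
    push_cast
    ring
  · intro p hp
    rw [mem_closure_openParallelogram_iff (linearIndependent_pair_mul_I (by exact_mod_cast hr0.ne'))]
      at hp
    obtain ⟨s, t, hs, hs1, ht, ht1, rfl⟩ := hp
    apply hball
    rw [Metric.mem_ball, dist_eq_norm]
    have hre : (x - (r / 2 : ℝ) - (r / 2 : ℝ) * I + s * r + t * (I * r) - x : ℂ) =
        ((s * r - r / 2 : ℝ) : ℂ) + ((t * r - r / 2 : ℝ) : ℂ) * I := by
      push_cast
      ring
    rw [hre]
    calc ‖((s * r - r / 2 : ℝ) : ℂ) + ((t * r - r / 2 : ℝ) : ℂ) * I‖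
        ≤ |s * r - r / 2| + |t * r - r / 2| := by
          refine (Complex.norm_le_abs_re_add_abs_im _).trans (le_of_eq ?_)
          simp [Complex.add_re, Complex.add_im]
      _ ≤ r / 2 + r / 2 := by
          gcongr <;> rw [abs_le] <;> constructor <;> nlinarith
      _ < ε := by rw [hr]; linarith

/-- For `s ⊆ U` whose image has closure inside `U`, the closure in `U` maps onto the closure in `ℂ`.
(Auxiliary.) [cite: MochizukiAbsTopIII2015, Proposition 2.5 (proof) pp.55–57] -/
theorem image_val_closure_eq {U : Set ℂ} {s : Set U} (h : closure (Subtype.val '' s) ⊆ U) :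
    Subtype.val '' closure s = closure (Subtype.val '' s) := by
  ext x
  constructor
  · rintro ⟨y, hy, rfl⟩
    exact closure_subtype.1 hy
  · intro hx
    exact ⟨⟨x, h hx⟩, closure_subtype.2 hx, rfl⟩

/-- A member `Q` of `𝒮(U)` (as a subset of the subtype `U`) is the preimage of the square `val '' Q`.
(Auxiliary.) [cite: MochizukiAbsTopIII2015, Proposition 2.5 (proof) pp.55–57] -/
theorem eq_preimage_image_val {U : Set ℂ} (Q : Set U) : Q = Subtype.val ⁻¹' (Subtype.val '' Q) :=
  (preimage_image_eq Q Subtype.val_injective).symm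

/-- **Prop 2.5, the topology**: for an open `U ⊆ ℂ`, the topology on `U` generated by the pre-compact squares
`𝒮(U)` ("which clearly forms a basis for, hence determines, the topology of `U`") is the subspace
topology. [cite: MochizukiAbsTopIII2015, Proposition 2.5 p.56] -/
theorem Parallelograms.topology_squaresIn_eq {U : Set ℂ} (hU : IsOpen U) :
    Parallelograms.topology {Q : Set U | Subtype.val '' Q ∈ squaresIn U} =
      instTopologicalSpaceSubtype := by
  refine (TopologicalSpace.IsTopologicalBasis.eq_generateFrom ?_).symm
  apply TopologicalSpace.isTopologicalBasis_of_isOpen_of_nhds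
  · rintro Q ⟨z, v, hv, hQ, -⟩
    rw [eq_preimage_image_val Q, hQ]
    exact (isOpen_openParallelogram (linearIndependent_pair_mul_I hv)).preimage continuous_subtype_val
  · intro x O hxO hO
    obtain ⟨W, hW, rfl⟩ := isOpen_induced_iff.1 hO
    have hxW : (x : ℂ) ∈ W ∩ U := ⟨hxO, x.2⟩
    obtain ⟨z, v, hv, hxP, hcl⟩ := exists_square_closure_subset (hW.inter hU) hxW
    have hPU : openParallelogram z v (I * v) ⊆ U :=
      subset_closure.trans (hcl.trans inter_subset_right)
    have himg : Subtype.val '' (Subtype.val ⁻¹' openParallelogram z v (I * v) : Set U) =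
        openParallelogram z v (I * v) := by
      rw [image_preimage_eq_inter_range, Subtype.range_coe, inter_eq_left.2 hPU]
    refine ⟨Subtype.val ⁻¹' openParallelogram z v (I * v), ⟨z, v, hv, himg.symm ▸ rfl, ?_⟩, hxP, ?_⟩
    · rw [himg]; exact hcl.trans inter_subset_right
    · exact preimage_mono (subset_closure.trans (hcl.trans inter_subset_left))

/-! ### Compact convex subsets of a line are segments -/

/-- A real-linear functional on `ℂ` in coordinates. (Auxiliary.) [cite: MochizukiAbsTopIII2015, Proposition 2.5 (proof) pp.55–57] -/
theorem realLinear_apply_eq (f : ℂ →L[ℝ] ℝ) (z : ℂ) : f z = z.re * f 1 + z.im * f I := by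
  have hz : z = z.re • (1 : ℂ) + z.im • I := by
    rw [Complex.real_smul, Complex.real_smul, mul_one, Complex.re_add_im]
  conv_lhs => rw [hz]
  rw [map_add, map_smul, map_smul, smul_eq_mul, smul_eq_mul]

/-- A non-empty compact convex subset of `ℂ` contained in a real line `{f = u}` (`f ≠ 0`) is a closed
segment. (Auxiliary.) [cite: MochizukiAbsTopIII2015, Proposition 2.5 (proof) pp.55–57] -/
theorem exists_eq_segment_of_subset_line {K : Set ℂ} (hKc : Convex ℝ K) (hK : IsCompact K)
    {f : ℂ →L[ℝ] ℝ} (hf : f ≠ 0) {u : ℝ} (hKf : K ⊆ {x | f x = u}) (hne : K.Nonempty) :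
    ∃ a b : ℂ, K = segment ℝ a b := by
  obtain ⟨x₀, hx₀⟩ := hne
  -- a direction vector of the line
  set d : ℂ := ⟨-(f I), f 1⟩ with hd_def
  have hN : (f 1) ^ 2 + (f I) ^ 2 ≠ 0 := by
    intro hN
    have h1 : f 1 = 0 := by nlinarith
    have h2 : f I = 0 := by nlinarith
    exact hf (by ext z; rw [realLinear_apply_eq, h1, h2]; simp)
  have hd : d ≠ 0 := by
    intro hd
    have h1 : f 1 = 0 := by simpa [hd_def] using congrArg Complex.im hd
    have h2 : f I = 0 := by simpa [hd_def] using congrArg Complex.re hd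
    exact hN (by rw [h1, h2]; ring)
  -- the parametrisation of the line through `x₀`
  set g : ℝ →ᵃ[ℝ] ℂ := AffineMap.lineMap x₀ (x₀ + d) with hg_def
  have hg : ∀ τ : ℝ, g τ = x₀ + (τ : ℂ) * d := by
    intro τ
    rw [hg_def, AffineMap.lineMap_apply_module, Complex.real_smul, Complex.real_smul]
    push_cast
    ring
  have hgc : Continuous g := by
    have : (g : ℝ → ℂ) = fun τ : ℝ => x₀ + (τ : ℂ) * d := funext hg
    rw [this]
    fun_prop
  -- `K` lies on that line
  have hKg : K ⊆ range g := by
    intro y hy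
    have hfy : f (y - x₀) = 0 := by
      rw [map_sub, show f y = u from hKf hy, show f x₀ = u from hKf hx₀, sub_self]
    rw [realLinear_apply_eq] at hfy
    refine ⟨((y - x₀).im * f 1 - (y - x₀).re * f I) / ((f 1) ^ 2 + (f I) ^ 2), ?_⟩
    rw [hg, ← eq_sub_iff_add_eq']
    apply Complex.ext
    · simp only [Complex.mul_re, Complex.ofReal_re, Complex.ofReal_im, hd_def]
      field_simp
      linear_combination (-(f 1)) * hfy
    · simp only [Complex.mul_im, Complex.ofReal_re, Complex.ofReal_im, hd_def]
      field_simp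
      linear_combination (-(f I)) * hfy
  -- the parameter set
  set T : Set ℝ := g ⁻¹' K with hT_def
  have hTconv : Convex ℝ T := hKc.affine_preimage g
  have hTclosed : IsClosed T := hK.isClosed.preimage hgc
  obtain ⟨R, hR⟩ := hK.isBounded.subset_closedBall x₀
  have hTsub : T ⊆ Icc (-(R / ‖d‖)) (R / ‖d‖) := by
    intro τ hτ
    have h1 : ‖(τ : ℂ) * d‖ ≤ R := by
      have := hR hτ
      rwa [Metric.mem_closedBall, dist_eq_norm, hg, add_sub_cancel_left] at this
    rw [norm_mul, Complex.norm_real, Real.norm_eq_abs] at h1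
    have hd' : 0 < ‖d‖ := norm_pos_iff.2 hd
    rw [mem_Icc, ← abs_le]
    rwa [le_div_iff₀ hd']
  have hTc : IsCompact T := isCompact_Icc.of_isClosed_subset hTclosed hTsub
  have h0T : (0 : ℝ) ∈ T := by show g 0 ∈ K; rw [hg]; simpa using hx₀
  have hTne : T.Nonempty := ⟨0, h0T⟩
  have hα : sInf T ∈ T := hTc.sInf_mem hTne
  have hβ : sSup T ∈ T := hTc.sSup_mem hTne
  have hαβ : sInf T ≤ sSup T := (csInf_le hTc.bddBelow h0T).trans (le_csSup hTc.bddAbove h0T)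
  have hTeq : T = Icc (sInf T) (sSup T) :=
    Subset.antisymm (fun τ hτ => ⟨csInf_le hTc.bddBelow hτ, le_csSup hTc.bddAbove hτ⟩)
      ((convex_iff_ordConnected.1 hTconv).out hα hβ)
  refine ⟨g (sInf T), g (sSup T), ?_⟩
  rw [← image_segment ℝ g, segment_eq_Icc hαβ, ← hTeq, hT_def, image_preimage_eq_of_subset hKg]

/-- An infinite (indeed: non-trivial) compact convex subset of a real line in `ℂ` is a non-degenerate
closed segment. (Auxiliary.) [cite: MochizukiAbsTopIII2015, Proposition 2.5 (proof) pp.55–57] -/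
theorem exists_eq_segment_of_subset_line' {K : Set ℂ} (hKc : Convex ℝ K) (hK : IsCompact K)
    {f : ℂ →L[ℝ] ℝ} (hf : f ≠ 0) {u : ℝ} (hKf : K ⊆ {x | f x = u}) (hne : K.Nontrivial) :
    ∃ a b : ℂ, a ≠ b ∧ K = segment ℝ a b := by
  obtain ⟨a, b, rfl⟩ := exists_eq_segment_of_subset_line hKc hK hf hKf hne.nonempty
  refine ⟨a, b, ?_, rfl⟩
  rintro rfl
  rw [segment_same] at hne
  exact hne.ne_singleton rfl

/-! ### Prop 2.5 (a): strict line segments are segments -/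

/-- Two disjoint open convex planar sets, one with compact closure, whose closures meet in an infinite
set: the intersection of the closures is a non-degenerate closed segment (Hahn–Banach separation).
(Auxiliary.) [cite: MochizukiAbsTopIII2015, Proposition 2.5 (proof) pp.55–57] -/
theorem exists_eq_segment_closure_inter_closure {s t : Set ℂ} (hs : Convex ℝ s) (hso : IsOpen s)
    (ht : Convex ℝ t) (hto : IsOpen t) (hst : Disjoint s t) (hsc : IsCompact (closure s))
    (hinf : (closure s ∩ closure t).Infinite) :
    ∃ a b : ℂ, a ≠ b ∧ closure s ∩ closure t = segment ℝ a b := by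
  obtain ⟨f, u, hfs, hft⟩ := geometric_hahn_banach_open_open hs hso ht hto hst
  obtain ⟨y, hy1, hy2⟩ := hinf.nonempty
  obtain ⟨a₀, ha₀⟩ := closure_nonempty_iff.1 ⟨y, hy1⟩
  obtain ⟨b₀, hb₀⟩ := closure_nonempty_iff.1 ⟨y, hy2⟩
  have hf0 : f ≠ 0 := by
    rintro rfl
    have h1 := hfs a₀ ha₀
    have h2 := hft b₀ hb₀
    simp only [zero_apply] at h1 h2
    linarith
  have hs' : closure s ⊆ {x | f x ≤ u} :=
    closure_minimal (fun a ha => (hfs a ha).le) (isClosed_le f.continuous continuous_const)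
  have ht' : closure t ⊆ {x | u ≤ f x} :=
    closure_minimal (fun b hb => (hft b hb).le) (isClosed_le continuous_const f.continuous)
  have hK : closure s ∩ closure t ⊆ {x | f x = u} := fun x hx =>
    le_antisymm (hs' hx.1) (ht' hx.2)
  exact exists_eq_segment_of_subset_line' (hs.closure.inter ht.closure)
    (hsc.inter_right isClosed_closure) hf0 hK hinf.nontrivial

/-- **Prop 2.5 (a)**, strict line segments: for an open `U ⊆ ℂ`, a strict line segment of `(U, 𝒮(U))` —
an infinite intersection `Q̄₁ ∩ Q̄₂` of the closures of two disjoint pre-compact squares — is (the trace on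
`U` of) a non-degenerate closed segment `[a, b]`, which lies in `U`.
[cite: MochizukiAbsTopIII2015, Proposition 2.5 (a) p.56] -/
theorem Parallelograms.IsStrictLineSegment.exists_eq_segment {U : Set ℂ} (hU : IsOpen U) {L : Set U}
    (hL : Parallelograms.IsStrictLineSegment {Q : Set U | Subtype.val '' Q ∈ squaresIn U} L) :
    ∃ a b : ℂ, a ≠ b ∧ Subtype.val '' L = segment ℝ a b := by
  obtain ⟨Q₁, hQ₁, Q₂, hQ₂, hdisj, hLeq, hinf⟩ := hL
  rw [Parallelograms.topology_squaresIn_eq hU] at hLeq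
  obtain ⟨z₁, v₁, hv₁, hP₁, hcl₁⟩ := hQ₁
  obtain ⟨z₂, v₂, hv₂, hP₂, hcl₂⟩ := hQ₂
  have key : Subtype.val '' L = closure (Subtype.val '' Q₁) ∩ closure (Subtype.val '' Q₂) := by
    rw [hLeq, image_inter Subtype.val_injective, image_val_closure_eq hcl₁, image_val_closure_eq hcl₂]
  rw [key]
  refine exists_eq_segment_closure_inter_closure ?_ ?_ ?_ ?_ ?_ ?_ ?_
  · rw [hP₁]; exact convex_openParallelogram _ _ _
  · rw [hP₁]; exact isOpen_openParallelogram (linearIndependent_pair_mul_I hv₁)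
  · rw [hP₂]; exact convex_openParallelogram _ _ _
  · rw [hP₂]; exact isOpen_openParallelogram (linearIndependent_pair_mul_I hv₂)
  · exact (disjoint_image_iff Subtype.val_injective).2 (disjoint_iff_inter_eq_empty.2 hdisj)
  · rw [hP₁]; exact isCompact_closure_openParallelogram (linearIndependent_pair_mul_I hv₁)
  · rw [← key]; exact hinf.image Subtype.val_injective.injOn

end

end Literature.AnabelianGeometry.AbsoluteAnabelian
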